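import Mathlib.Analysis.SpecialFunctions.Gaussian.FourierTransform
import Mathlib.MeasureTheory.Integral.IntervalIntegral.FundThmCalculus
import Literature.Analysis.FluidPDE.TypeIAncientMildClassical
import Literature.Analysis.FluidPDE.AncientSimilarityVariables
import HarnessLib

/-!
# Crux `NoTypeIBlowup` (stmt-NavierStokesRegularity-1217), line `head-flux-channel`:
  STUB S3, the head-flux criterion (`stub_headFluxCriterion`)

In backward similarity variables `U = lerayOrbit u` (`U(s, y) = e^{-s/2} u(-e^{-s}, e^{-s/2} y)`)
with the Gaussian weight `G(y) = e^{-‖y‖²/4}`, a Type-I ancient mild field `u`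
(`IsTypeIAncientMild C u`, so `‖U‖ ≤ C`) carries the three Gaussian functionals
`E(s) = ∫ ½‖U‖² G` (energy), `D(s) = ∫ |∇U|²_F G ≥ 0` (dissipation) and
`Ch(s) = ∫ (½‖U‖² + P)⟪y, U⟫ G` (head-flux channel, `P = lerayOrbitPressure p`).

`stub_headFluxCriterion`: GIVEN continuity of `D` and `Ch`, the energy identity
`E' = -D - E - ½Ch` at every `s`, and the head-influx law
`∫ₐᵇ (-½Ch) ≤ (1 - ε) ∫ₐᵇ (D + E)` on all windows `a + S₀ ≤ b` (`ε > 0`), the field vanishes: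
`u(t, x) = 0` for `t < 0`.

Proof (pure real analysis + definiteness of `E`).
* `headFlux_energy_eq_zero` — the abstract backward-Grönwall step on the line: for real functions
  `0 ≤ E ≤ M`, `0 ≤ D`, `D, Ch` continuous, `E' = -D - E - Ch/2`, and the law, one gets on windows
  `a + S₁ ≤ b` (`S₁ = max S₀ 0`) `ε ∫ₐᵇ (D + E) ≤ E(a) - E(b)` (FTC), hence `E(b) ≤ E(a)` and
  `ε ∫ₐᵇ (D + E) ≤ M`; if `E(b) > 0` then `∫ₐᵇ E ≥ (b - S₁ - a) E(b)` is unbounded as `a → -∞`,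
  contradiction; so `E ≡ 0`.
* `E(s) = 0` with the continuous nonnegative integrable integrand `½‖U(s, ·)‖² G` forces
  `U(s, ·) = 0` (`integral_eq_zero_iff_of_nonneg`, `Continuous.ae_eq_iff_eq`), and
  `u(t, x) = (√(-t))⁻¹ U(-log(-t), x/√(-t)) = 0` (`eq_lerayOrbit_of_neg`).

Gaussian integrability is Mathlib's `GaussianFourier.integrable_cexp_neg_mul_sq_norm_add`;
the bound `‖U(s, y)‖ ≤ C` is `IsTypeIAncientMild.norm_le` read at `t = -e^{-s}`.
Lands `--supports stmt-NavierStokesRegularity-1217`.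
-/

noncomputable section

namespace Summit.NavierStokesRegularity.NavierStokesRegularity.Theorems

open MeasureTheory Set Filter Topology
open scoped RealInnerProductSpace
open Literature.Analysis.FluidPDE

/-! ### The abstract backward-Grönwall step -/

/-- **Backward Grönwall on the line.** Let `E, D, Ch : ℝ → ℝ` with `0 ≤ E ≤ M`, `0 ≤ D`, `D` and
`Ch` continuous, `E' = -D - E - Ch/2` everywhere, and suppose the law
`∫ₐᵇ (-Ch/2) ≤ (1 - ε) ∫ₐᵇ (D + E)` holds whenever `a + S₀ ≤ b`, for some `ε > 0`. Then `E ≡ 0`: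
on long windows `ε ∫ₐᵇ (D + E) ≤ E(a) - E(b)`, so `E` is backward-monotone and
`∫ₐᵇ E ≤ M/ε`, while `∫ₐᵇ E ≥ (b - S₁ - a) E(b)`; letting `a → -∞` gives `E(b) = 0`. -/
theorem headFlux_energy_eq_zero {E D Ch : ℝ → ℝ} {M ε S₀ : ℝ}
    (hE0 : ∀ s, 0 ≤ E s) (hEM : ∀ s, E s ≤ M) (hD0 : ∀ s, 0 ≤ D s)
    (hDc : Continuous D) (hChc : Continuous Ch)
    (hderiv : ∀ s, HasDerivAt E (-(D s) - E s - Ch s / 2) s) (hε : 0 < ε)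
    (hlaw : ∀ a b : ℝ, a + S₀ ≤ b →
      (∫ s in a..b, -(Ch s) / 2) ≤ (1 - ε) * ∫ s in a..b, (D s + E s)) (s : ℝ) :
    E s = 0 := by
  have hEc : Continuous E := continuous_iff_continuousAt.2 fun σ => (hderiv σ).continuousAt
  -- the fundamental theorem of calculus on `[a, b]`
  have hftc : ∀ a b : ℝ,
      E b - E a = (∫ σ in a..b, -(Ch σ) / 2) - ∫ σ in a..b, (D σ + E σ) := by
    intro a b
    have I1 : IntervalIntegrable (fun σ => -(Ch σ) / 2) volume a b :=
      (hChc.neg.div_const 2).intervalIntegrable a b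
    have I2 : IntervalIntegrable (fun σ => D σ + E σ) volume a b :=
      (hDc.add hEc).intervalIntegrable a b
    have I3 : IntervalIntegrable (fun σ => -(D σ) - E σ - Ch σ / 2) volume a b :=
      ((hDc.neg.sub hEc).sub (hChc.div_const 2)).intervalIntegrable a b
    have h1 : (∫ σ in a..b, (-(D σ) - E σ - Ch σ / 2)) = E b - E a :=
      intervalIntegral.integral_eq_sub_of_hasDerivAt (fun σ _ => hderiv σ) I3
    rw [← h1, ← intervalIntegral.integral_sub I1 I2]
    refine intervalIntegral.integral_congr fun σ _ => ?_
    ring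
  -- windows of length at least `S₁ = max S₀ 0`
  obtain ⟨S₁, hS₀S₁, h0S₁⟩ : ∃ S₁ : ℝ, S₀ ≤ S₁ ∧ 0 ≤ S₁ :=
    ⟨max S₀ 0, le_max_left _ _, le_max_right _ _⟩
  have hInn : ∀ a b : ℝ, a ≤ b → 0 ≤ ∫ σ in a..b, (D σ + E σ) := fun a b hab =>
    intervalIntegral.integral_nonneg hab fun σ _ => add_nonneg (hD0 σ) (hE0 σ)
  have hkey : ∀ a b : ℝ, a + S₁ ≤ b → ε * ∫ σ in a..b, (D σ + E σ) ≤ E a - E b := by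
    intro a b hab
    have h := hlaw a b (by linarith)
    have h2 := hftc a b
    have h3 : (1 - ε) * (∫ σ in a..b, (D σ + E σ)) =
        (∫ σ in a..b, (D σ + E σ)) - ε * ∫ σ in a..b, (D σ + E σ) := by ring
    linarith
  have hmono : ∀ a b : ℝ, a + S₁ ≤ b → E b ≤ E a := by
    intro a b hab
    have h1 := hkey a b hab
    have h2 : 0 ≤ ε * ∫ σ in a..b, (D σ + E σ) := mul_nonneg hε.le (hInn a b (by linarith))
    linarith
  have hbound : ∀ a b : ℝ, a + S₁ ≤ b → ε * ∫ σ in a..b, (D σ + E σ) ≤ M := fun a b hab =>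
    (hkey a b hab).trans (by linarith [hEM a, hE0 b])
  -- if `E s > 0`, a window `[a, s]` with `s - S₁ - a` large contradicts `hbound`
  by_contra hne
  have hpos : 0 < E s := lt_of_le_of_ne (hE0 s) (Ne.symm hne)
  have hM0 : 0 ≤ M := (hE0 s).trans (hEM s)
  obtain ⟨L, hLE⟩ : ∃ L : ℝ, L * E s = M / ε + 1 :=
    ⟨(M / ε + 1) / E s, div_mul_cancel₀ _ hpos.ne'⟩
  obtain ⟨a, ha⟩ : ∃ a : ℝ, s - S₁ - a = L := ⟨s - S₁ - L, by ring⟩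
  have hL0 : 0 ≤ L := by
    by_contra hL
    have : L * E s < 0 := mul_neg_of_neg_of_pos (lt_of_not_ge hL) hpos
    have : 0 < M / ε + 1 := by positivity
    linarith
  have hab' : a ≤ s - S₁ := by linarith
  have haS : a + S₁ ≤ s := by linarith
  have hlow : L * E s ≤ ∫ σ in a..(s - S₁), E σ := by
    have h1 : (∫ _σ in a..(s - S₁), E s) = L * E s := by
      rw [intervalIntegral.integral_const, smul_eq_mul, ha]
    rw [← h1]
    exact intervalIntegral.integral_mono_on hab' intervalIntegrable_const
      (hEc.intervalIntegrable _ _) fun σ hσ => hmono σ s (by linarith [hσ.2])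
  have hmid : (∫ σ in a..(s - S₁), E σ) ≤ ∫ σ in a..s, E σ :=
    intervalIntegral.integral_mono_interval le_rfl hab' (by linarith)
      (Eventually.of_forall fun σ => hE0 σ) (hEc.intervalIntegrable _ _)
  have hup : (∫ σ in a..s, E σ) ≤ ∫ σ in a..s, (D σ + E σ) :=
    intervalIntegral.integral_mono_on (by linarith) (hEc.intervalIntegrable _ _)
      ((hDc.add hEc).intervalIntegrable _ _) fun σ _ => le_add_of_nonneg_left (hD0 σ)
  have hfin : ε * (L * E s) ≤ M :=
    (mul_le_mul_of_nonneg_left (hlow.trans (hmid.trans hup)) hε.le).trans (hbound a s haS)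
  rw [hLE, mul_add, mul_one, mul_div_cancel₀ _ hε.ne'] at hfin
  linarith

/-! ### Gaussian bookkeeping on `ℝ³` -/

/-- Real Gaussians `e^{-b‖y‖²}`, `b > 0`, are integrable on `ℝ³` (norm of Mathlib's
`GaussianFourier.integrable_cexp_neg_mul_sq_norm_add`). -/
theorem headFlux_integrable_exp_neg_mul_sq_norm {b : ℝ} (hb : 0 < b) :
    Integrable (fun y : EuclideanSpace ℝ (Fin 3) => Real.exp (-b * ‖y‖ ^ 2)) := by
  have h := (GaussianFourier.integrable_cexp_neg_mul_sq_norm_add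
    (V := EuclideanSpace ℝ (Fin 3)) (b := (b : ℂ)) (by simpa using hb) 0 0).norm
  refine h.congr (ae_of_all _ fun y => ?_)
  have h1 : (-(b : ℂ) * (‖y‖ : ℂ) ^ 2 + 0 * (⟪(0 : EuclideanSpace ℝ (Fin 3)), y⟫ : ℂ)) =
      ((-b * ‖y‖ ^ 2 : ℝ) : ℂ) := by
    push_cast
    ring
  simp only [h1, Complex.norm_exp, Complex.ofReal_re]

/-- The Ornstein–Uhlenbeck Gaussian `G(y) = e^{-‖y‖²/4}` is integrable on `ℝ³`. -/
theorem headFlux_integrable_gauss :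
    Integrable (fun y : EuclideanSpace ℝ (Fin 3) => Real.exp (-‖y‖ ^ 2 / 4)) := by
  refine (headFlux_integrable_exp_neg_mul_sq_norm (b := 1 / 4) (by norm_num)).congr
    (ae_of_all _ fun y => ?_)
  show Real.exp _ = Real.exp _
  congr 1
  ring

/-- **The Type-I rate in similarity variables**: `‖U(s, y)‖ ≤ C` for `U = lerayOrbit u`,
`IsTypeIAncientMild C u` (`‖U(s, y)‖ = e^{-s/2} ‖u(-e^{-s}, ·)‖ ≤ e^{-s/2} · C/√(e^{-s}) = C`). -/
theorem headFlux_norm_lerayOrbit_le {C : ℝ}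
    {u : ℝ → EuclideanSpace ℝ (Fin 3) → EuclideanSpace ℝ (Fin 3)} (h : IsTypeIAncientMild C u)
    (s : ℝ) (y : EuclideanSpace ℝ (Fin 3)) : ‖lerayOrbit u s y‖ ≤ C := by
  have hpos : 0 < Real.exp (-s / 2) := Real.exp_pos _
  have key := h.norm_le (t := -Real.exp (-s)) (neg_exp_neg_lt_zero s) (Real.exp (-s / 2) • y)
  rw [neg_neg, sqrt_exp_neg] at key
  rw [lerayOrbit_apply, norm_smul, Real.norm_of_nonneg hpos.le]
  calc Real.exp (-s / 2) * ‖u (-Real.exp (-s)) (Real.exp (-s / 2) • y)‖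
      ≤ Real.exp (-s / 2) * (C / Real.exp (-s / 2)) := by gcongr
    _ = C := by field_simp

/-- The slices `U(s, ·)` of the Leray orbit of a Type-I ancient mild field are continuous. -/
theorem headFlux_continuous_lerayOrbit {C : ℝ}
    {u : ℝ → EuclideanSpace ℝ (Fin 3) → EuclideanSpace ℝ (Fin 3)} (h : IsTypeIAncientMild C u)
    (s : ℝ) : Continuous (lerayOrbit u s) :=
  ((h.continuous_slice (neg_exp_neg_lt_zero s)).comp
    (continuous_const_smul (Real.exp (-s / 2)))).const_smul (Real.exp (-s / 2))

/-! ### The stub -/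

/-- **S3 — the HEAD-FLUX CRITERION** (line `head-flux-channel` of crux `NoTypeIBlowup`): closing
the head-flux channel on long similarity-time windows forces triviality. Let `u` be a Type-I
ancient mild field (constant `C`) and `p` any scalar field; write, with `U = lerayOrbit u`,
`P = lerayOrbitPressure p`, `G = e^{-‖y‖²/4}`: `E(s) = ∫ ½‖U‖² G`, `D(s) = ∫ |∇U|²_F G`,
`Ch(s) = ∫ (½‖U‖² + P)⟪y, U⟫ G`. If `D` and `Ch` are continuous, `E' = -D - E - ½Ch` at every
`s`, and `∫ₐᵇ (-½Ch) ≤ (1 - ε) ∫ₐᵇ (D + E)` on every window `a + S₀ ≤ b` for some `ε > 0`, then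
`u(t, ·) = 0` for all `t < 0`. Proof: `0 ≤ E ≤ ½C² ∫G`, `0 ≤ D`, and the backward-Grönwall step
`headFlux_energy_eq_zero` give `E ≡ 0`; the continuous nonnegative integrand `½‖U(s, ·)‖² G`
then vanishes identically, so `U ≡ 0` and `u(t, x) = (√(-t))⁻¹ U(-log(-t), x/√(-t)) = 0`. -/
theorem stub_headFluxCriterion :
    ∀ (C : ℝ) (u : ℝ → EuclideanSpace ℝ (Fin 3) → EuclideanSpace ℝ (Fin 3))
      (p : ℝ → EuclideanSpace ℝ (Fin 3) → ℝ),
      IsTypeIAncientMild C u →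
      Continuous (fun s : ℝ =>
          ∫ y, frobeniusNormSq (fderiv ℝ (lerayOrbit u s) y) * Real.exp (-‖y‖ ^ 2 / 4)) →
      Continuous (fun s : ℝ =>
          ∫ y, (‖lerayOrbit u s y‖ ^ 2 / 2 + lerayOrbitPressure p s y) *
            ⟪y, lerayOrbit u s y⟫ * Real.exp (-‖y‖ ^ 2 / 4)) →
      (∀ s : ℝ,
        HasDerivAt (fun σ : ℝ => ∫ y, ‖lerayOrbit u σ y‖ ^ 2 / 2 * Real.exp (-‖y‖ ^ 2 / 4))
          (-(∫ y, frobeniusNormSq (fderiv ℝ (lerayOrbit u s) y) * Real.exp (-‖y‖ ^ 2 / 4))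
            - (∫ y, ‖lerayOrbit u s y‖ ^ 2 / 2 * Real.exp (-‖y‖ ^ 2 / 4))
            - (∫ y, (‖lerayOrbit u s y‖ ^ 2 / 2 + lerayOrbitPressure p s y) *
                ⟪y, lerayOrbit u s y⟫ * Real.exp (-‖y‖ ^ 2 / 4)) / 2) s) →
      (∃ ε : ℝ, 0 < ε ∧ ∃ S₀ : ℝ, ∀ a b : ℝ, a + S₀ ≤ b →
        (∫ s in a..b, -(∫ y, (‖lerayOrbit u s y‖ ^ 2 / 2 + lerayOrbitPressure p s y) *
            ⟪y, lerayOrbit u s y⟫ * Real.exp (-‖y‖ ^ 2 / 4)) / 2) ≤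
          (1 - ε) * ∫ s in a..b,
            ((∫ y, frobeniusNormSq (fderiv ℝ (lerayOrbit u s) y) * Real.exp (-‖y‖ ^ 2 / 4)) +
              ∫ y, ‖lerayOrbit u s y‖ ^ 2 / 2 * Real.exp (-‖y‖ ^ 2 / 4))) →
      ∀ t < 0, ∀ x, u t x = 0 := by
  intro C u p hu hD hCh hE' hlaw t ht x
  obtain ⟨ε, hε, S₀, hlaw⟩ := hlaw
  -- Gaussian bookkeeping: `0 ≤ E ≤ ½C² ∫G`, `0 ≤ D`
  have hG := headFlux_integrable_gauss
  have hGc : Continuous fun y : EuclideanSpace ℝ (Fin 3) => Real.exp (-‖y‖ ^ 2 / 4) :=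
    ((continuous_norm.pow 2).neg.div_const 4).rexp
  have hUc : ∀ s, Continuous (lerayOrbit u s) := headFlux_continuous_lerayOrbit hu
  have hUC : ∀ s y, ‖lerayOrbit u s y‖ ≤ C := headFlux_norm_lerayOrbit_le hu
  have hIc : ∀ s, Continuous fun y =>
      ‖lerayOrbit u s y‖ ^ 2 / 2 * Real.exp (-‖y‖ ^ 2 / 4) := fun s =>
    (((hUc s).norm.pow 2).div_const 2).mul hGc
  have hnn : ∀ s y, 0 ≤ ‖lerayOrbit u s y‖ ^ 2 / 2 * Real.exp (-‖y‖ ^ 2 / 4) := fun s y => by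
    positivity
  have hpt : ∀ s y, ‖lerayOrbit u s y‖ ^ 2 / 2 * Real.exp (-‖y‖ ^ 2 / 4) ≤
      C ^ 2 / 2 * Real.exp (-‖y‖ ^ 2 / 4) := fun s y =>
    mul_le_mul_of_nonneg_right
      (div_le_div_of_nonneg_right (pow_le_pow_left₀ (norm_nonneg _) (hUC s y) 2) zero_le_two)
      (Real.exp_pos _).le
  have hint : ∀ s, Integrable fun y => ‖lerayOrbit u s y‖ ^ 2 / 2 * Real.exp (-‖y‖ ^ 2 / 4) :=
    fun s => (hG.const_mul (C ^ 2 / 2)).mono' (hIc s).aestronglyMeasurable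
      (Eventually.of_forall fun y => by
        rw [Real.norm_of_nonneg (hnn s y)]
        exact hpt s y)
  have hE0 : ∀ s, 0 ≤ ∫ y, ‖lerayOrbit u s y‖ ^ 2 / 2 * Real.exp (-‖y‖ ^ 2 / 4) := fun s =>
    integral_nonneg fun y => hnn s y
  have hEM : ∀ s, (∫ y, ‖lerayOrbit u s y‖ ^ 2 / 2 * Real.exp (-‖y‖ ^ 2 / 4)) ≤
      C ^ 2 / 2 * ∫ y : EuclideanSpace ℝ (Fin 3), Real.exp (-‖y‖ ^ 2 / 4) := fun s => by
    rw [← integral_const_mul]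
    exact integral_mono (hint s) (hG.const_mul _) fun y => hpt s y
  have hD0 : ∀ s, 0 ≤ ∫ y, frobeniusNormSq (fderiv ℝ (lerayOrbit u s) y) *
      Real.exp (-‖y‖ ^ 2 / 4) := fun s =>
    integral_nonneg fun y => mul_nonneg (frobeniusNormSq_nonneg _) (Real.exp_pos _).le
  -- the backward-Grönwall step: `E ≡ 0`
  have hzero : ∀ s, (∫ y, ‖lerayOrbit u s y‖ ^ 2 / 2 * Real.exp (-‖y‖ ^ 2 / 4)) = 0 :=
    headFlux_energy_eq_zero
      (E := fun s => ∫ y, ‖lerayOrbit u s y‖ ^ 2 / 2 * Real.exp (-‖y‖ ^ 2 / 4))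
      (D := fun s => ∫ y, frobeniusNormSq (fderiv ℝ (lerayOrbit u s) y) *
        Real.exp (-‖y‖ ^ 2 / 4))
      (Ch := fun s => ∫ y, (‖lerayOrbit u s y‖ ^ 2 / 2 + lerayOrbitPressure p s y) *
        ⟪y, lerayOrbit u s y⟫ * Real.exp (-‖y‖ ^ 2 / 4))
      hE0 hEM hD0 hD hCh hE' hε hlaw
  -- definiteness: `U ≡ 0`
  have hU : ∀ s y, lerayOrbit u s y = 0 := by
    intro s y
    have h1 := (integral_eq_zero_iff_of_nonneg (fun y => hnn s y) (hint s)).1 (hzero s)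
    have h2 := ((hIc s).ae_eq_iff_eq volume continuous_zero).1 h1
    have h3 : ‖lerayOrbit u s y‖ ^ 2 / 2 * Real.exp (-‖y‖ ^ 2 / 4) = 0 := congrFun h2 y
    have h4 : ‖lerayOrbit u s y‖ ^ 2 = 0 := by
      rcases mul_eq_zero.1 h3 with h | h
      · linarith
      · exact absurd h (Real.exp_pos _).ne'
    exact norm_eq_zero.1 ((pow_eq_zero_iff two_ne_zero).1 h4)
  -- back to physical variables
  rw [eq_lerayOrbit_of_neg u ht x, hU, smul_zero]

end Summit.NavierStokesRegularity.NavierStokesRegularity.Theorems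

end
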